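import Summits.AtomisticToContinuum.Crystallization.Theorems.PerronTransitivityNoFractionalGainHeartSubBoundCase

/-!
# Crux `PerronTransitivity.NoFractionalGain` (stmt-AtomisticToContinuum-15098), line `merge-perron`:
# K* holds on every vertex-transitive separated crystal

A true sub-case of the crux K* and of the open stub `stub_copositiveKepler` in its spectral regime,
generalising the landed hcp case (`perronKepler_on_hcp_subsets`, p160355) from hcp to EVERY periodic
configuration `P` of `ℝ³` that is

* VERTEX-TRANSITIVE — for all `p, q ∈ P.points` some isometry `φ` of `ℝ³` maps `P.points` onto itself and
  `p` to `q` (fcc, hcp, bcc, sc, sh, diamond … at every scale), and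
* `2^{-1/6}`-SEPARATED — `dist⁶ ≥ 1/2` between distinct points (every pair attracts).

Then every site sum equals `2·e_LJ(P)` (`tsum_site_eq_two_mul_energyPerParticle_of_transitive`: site sums
are symmetry-invariant and `e_LJ(P)` is their motif average), so `P.points` is a `(−2e_LJ(P))`-sub-bound
separated environment and the landed one-centre regime (`perronKepler_on_subBound_pieces`, p160884) gives,
for every injective finite family `x` of points of `P` and ALL real weights `c`,
`2·e_LJ(P)·∑cᵢ² ≤ ∑_{i≠j} cᵢcⱼV_LJ(dist xᵢ xⱼ)` (`perronKepler_on_transitive_subsets`), hence the crux's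
inequality `2E*·∑cᵢ² ≤ …` there (`noFractionalGain_on_transitive_subsets`, `E* ≤ e_LJ(P)`).  Reading: on a
transitive crystal the uniform vector is the Perron vector of the infinite binding kernel, whose norm
`−2e_LJ(P) ≤ 2|E*|` bounds every finite compression — fractional occupation of a transitive crystal never
gains.  What transitivity does NOT cover is exactly the open content of K*: non-transitive competitors
(dhcp-type polytypes, Frank–Kasper phases) and non-periodic weighted clusters.
-/

noncomputable section

namespace Summit.AtomisticToContinuum.Crystallization.Theorems.PerronTransitivity.NoFractionalGain

open Literature.MathematicalPhysics.StatisticalMechanics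
open scoped BigOperators

/-- **Site sums of a periodic configuration are invariant under its symmetries**: if the isometry `φ`
of `ℝ³` maps `P.points` onto itself then the site sum at `φ p` equals the site sum at `p`. [folklore] -/
theorem tsum_site_eq_of_isometryEquiv (P : PeriodicConfiguration 3) (V : ℝ → ℝ)
    (φ : EuclideanSpace ℝ (Fin 3) ≃ᵢ EuclideanSpace ℝ (Fin 3))
    (hφ : ∀ z, z ∈ P.points ↔ φ z ∈ P.points) (p : EuclideanSpace ℝ (Fin 3)) :
    ∑' q : {q : EuclideanSpace ℝ (Fin 3) // q ∈ P.points ∧ q ≠ φ p}, V (dist (φ p) q.1) =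
      ∑' q : {q : EuclideanSpace ℝ (Fin 3) // q ∈ P.points ∧ q ≠ p}, V (dist p q.1) := by
  let e : {q : EuclideanSpace ℝ (Fin 3) // q ∈ P.points ∧ q ≠ p} ≃
      {q : EuclideanSpace ℝ (Fin 3) // q ∈ P.points ∧ q ≠ φ p} :=
    { toFun := fun q => ⟨φ q.1, (hφ q.1).1 q.2.1, fun h => q.2.2 (φ.injective h)⟩
      invFun := fun q => ⟨φ.symm q.1, by
          have h := (hφ (φ.symm q.1)).2
          rw [φ.apply_symm_apply] at h
          exact h q.2.1, fun h => q.2.2 (by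
            have h' := congrArg φ h
            rwa [φ.apply_symm_apply] at h')⟩
      left_inv := fun q => by simp
      right_inv := fun q => by simp }
  rw [← Equiv.tsum_eq e]
  refine tsum_congr fun q => ?_
  change V (dist (φ p) (φ q.1)) = V (dist p q.1)
  rw [φ.dist_eq]

/-- **On a vertex-transitive periodic configuration every site sum equals `2·e(P)`** (for any pair
potential `V`): the site sums are all equal by symmetry, and `e(P)` is by definition half their average
over the motif. [folklore] -/
theorem tsum_site_eq_two_mul_energyPerParticle_of_transitive (P : PeriodicConfiguration 3) (V : ℝ → ℝ)
    (htrans : ∀ p ∈ P.points, ∀ q ∈ P.points,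
      ∃ φ : EuclideanSpace ℝ (Fin 3) ≃ᵢ EuclideanSpace ℝ (Fin 3),
        (∀ z, z ∈ P.points ↔ φ z ∈ P.points) ∧ φ p = q)
    {p : EuclideanSpace ℝ (Fin 3)} (hp : p ∈ P.points) :
    ∑' q : {q : EuclideanSpace ℝ (Fin 3) // q ∈ P.points ∧ q ≠ p}, V (dist p q.1) =
      2 * P.energyPerParticle V := by
  have hconst : ∀ x ∈ P.motif,
      ∑' q : {q : EuclideanSpace ℝ (Fin 3) // q ∈ P.points ∧ q ≠ x}, V (dist x q.1) =
        ∑' q : {q : EuclideanSpace ℝ (Fin 3) // q ∈ P.points ∧ q ≠ p}, V (dist p q.1) := by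
    intro x hx
    obtain ⟨φ, hφ, rfl⟩ := htrans p hp x (P.mem_points_of_mem_motif hx)
    exact tsum_site_eq_of_isometryEquiv P V φ hφ p
  unfold PeriodicConfiguration.energyPerParticle
  rw [Finset.sum_congr rfl hconst, Finset.sum_const, nsmul_eq_mul]
  have hc : (P.motif.card : ℝ) ≠ 0 := by exact_mod_cast P.motif_nonempty.card_pos.ne'
  field_simp

/-- **The Perron–Kepler bound on finite pieces of a vertex-transitive separated crystal, with its own
constant.**  If `P` is vertex-transitive and its points are `2^{-1/6}`-separated (`dist⁶ ≥ 1/2`), then for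
every injective finite family `x` of points of `P` and ALL real `c`,
`2·e_LJ(P)·∑cᵢ² ≤ ∑_{i≠j} cᵢcⱼV_LJ(dist xᵢ xⱼ)` — sharp as the piece exhausts `P` (`c ≡ 1`). [folklore] -/
theorem perronKepler_on_transitive_subsets (P : PeriodicConfiguration 3)
    (htrans : ∀ p ∈ P.points, ∀ q ∈ P.points,
      ∃ φ : EuclideanSpace ℝ (Fin 3) ≃ᵢ EuclideanSpace ℝ (Fin 3),
        (∀ z, z ∈ P.points ↔ φ z ∈ P.points) ∧ φ p = q)
    (hsepP : ∀ p ∈ P.points, ∀ q ∈ P.points, p ≠ q → (1 : ℝ) / 2 ≤ dist p q ^ 6)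
    {N : ℕ} (x : Fin N → EuclideanSpace ℝ (Fin 3)) (hx : Function.Injective x)
    (hmem : ∀ i, x i ∈ P.points) (c : Fin N → ℝ) :
    2 * P.energyPerParticle lennardJones * ∑ i, c i ^ 2 ≤
      ∑ i, ∑ j ∈ Finset.univ.erase i, c i * c j * lennardJones (dist (x i) (x j)) := by
  have h := perronKepler_on_subBound_pieces (-(2 * P.energyPerParticle lennardJones)) hsepP
    (fun p _ => P.summable_lennardJones_dist_three p)
    (fun p hp => by
      rw [tsum_site_eq_two_mul_energyPerParticle_of_transitive P lennardJones htrans hp, neg_neg])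
    x hx hmem c
  simpa using h

/-- **K* holds on every vertex-transitive separated crystal** (a true sub-case of the crux
`PerronTransitivity.NoFractionalGain`, stmt-AtomisticToContinuum-15098, for all real weights): for `P`
vertex-transitive with `2^{-1/6}`-separated points, every injective finite family `x` of its points and every
`c : Fin N → ℝ`, `2E*·∑cᵢ² ≤ ∑_{i≠j} cᵢcⱼV_LJ(dist xᵢ xⱼ)`, `E* = ⨅_Q e_LJ(Q) ≤ e_LJ(P)`. [folklore] -/
theorem noFractionalGain_on_transitive_subsets : ∀ (P : PeriodicConfiguration 3),
    (∀ p ∈ P.points, ∀ q ∈ P.points,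
      ∃ φ : EuclideanSpace ℝ (Fin 3) ≃ᵢ EuclideanSpace ℝ (Fin 3),
        (∀ z, z ∈ P.points ↔ φ z ∈ P.points) ∧ φ p = q) →
    (∀ p ∈ P.points, ∀ q ∈ P.points, p ≠ q → (1 : ℝ) / 2 ≤ dist p q ^ 6) →
    ∀ (N : ℕ) (x : Fin N → EuclideanSpace ℝ (Fin 3)), Function.Injective x →
      (∀ i, x i ∈ P.points) → ∀ c : Fin N → ℝ,
        2 * (⨅ Q : PeriodicConfiguration 3, Q.energyPerParticle lennardJones) * ∑ i, c i ^ 2 ≤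
          ∑ i, ∑ j ∈ Finset.univ.erase i, c i * c j * lennardJones (dist (x i) (x j)) := by
  intro P htrans hsepP N x hx hmem c
  have h1 := perronKepler_on_transitive_subsets P htrans hsepP x hx hmem c
  have h2 : (⨅ Q : PeriodicConfiguration 3, Q.energyPerParticle lennardJones) ≤
      P.energyPerParticle lennardJones :=
    ciInf_le Summit.AtomisticToContinuum.Crystallization.Theorems.ChargedEnergyGapNegative.bddBelow_energyPerParticle_lennardJones P
  have h3 : 0 ≤ ∑ i, c i ^ 2 := Finset.sum_nonneg fun i _ => sq_nonneg (c i)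
  have h4 : 2 * (⨅ Q : PeriodicConfiguration 3, Q.energyPerParticle lennardJones) * ∑ i, c i ^ 2 ≤
      2 * P.energyPerParticle lennardJones * ∑ i, c i ^ 2 :=
    mul_le_mul_of_nonneg_right (by linarith) h3
  exact h4.trans h1

end Summit.AtomisticToContinuum.Crystallization.Theorems.PerronTransitivity.NoFractionalGain

end
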